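import Mathlib
import HarnessLib

/-!
# Route `CompletionRelayChain` — crux `RelayFrontStep` (stmt-NavierStokesRegularity-24850), K-side of `stub_phaseI`,
  work package K1 (`Cruxes/RelayFrontStep/K-PLAN-stub_phaseI.md`): DEGREE-2 TAYLOR-MODEL ARITHMETIC over `ℚ` with real semantics

A Taylor model in `q` parameters `θ ∈ [−1,1]^q` of degree `≤ 2` is `p(θ) = c₀ + Σᵢ ℓᵢθᵢ + Σ_{i≤j} Q_{ij}θᵢθⱼ`
with rational coefficients together with a remainder radius `ρ ≥ 0`; it CONTAINS a real number `x` at `θ` when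
`|x − p(θ)| ≤ ρ` (`TM.Contains`). This file gives the computable operations the Phase-I checker needs — `add`,
`smul`, `mul` (product truncated to degree `2`, the cubic/quartic part and the remainder cross terms bounded into
the new radius using `|θᵢ| ≤ 1`), `rangeHi`/`rangeLo` (interval hull over the box) — and their SOUNDNESS:
`contains_add`, `contains_smul`, `contains_mul`, `le_rangeHi`/`rangeLo_le`. Pure algebra; the format's flat
graded-lex coefficient lists (`…PhaseIFormat.lean`, p611831) are decoded into this structure by the checker (K4).

Definitions + lemmas; nothing about any flow. MODEL-lattice bookkeeping (rung TL-M3-R64); nothing here is a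
statement about the Navier–Stokes equations.
-/

-- the summit-side namespace `Summit.NavierStokesRegularity.NavierStokesRegularity.…` (single-conjunct summit,
-- D-0017) repeats a component by design; the dupNamespace linter would flag every declaration.
set_option linter.dupNamespace false

namespace Summit.NavierStokesRegularity.NavierStokesRegularity.Cruxes.RelayFrontStep.PhaseI

open scoped BigOperators
open Finset

/-- A degree-`≤ 2` Taylor model in `q` parameters over `ℚ`: constant, linear and (upper-triangular) quadratic
coefficients and a remainder radius. Only the entries `quad i j` with `i ≤ j` are used. [folklore] -/
structure TM (q : ℕ) where
  /-- constant coefficient -/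
  c0 : ℚ
  /-- linear coefficients -/
  lin : Fin q → ℚ
  /-- quadratic coefficients (`i ≤ j` used) -/
  quad : Fin q → Fin q → ℚ
  /-- remainder radius -/
  rem : ℚ

namespace TM

variable {q : ℕ}

/-- The polynomial part evaluated at a real parameter point. [folklore] -/
noncomputable def evalR (p : TM q) (θ : Fin q → ℝ) : ℝ :=
  (p.c0 : ℝ) + ∑ i, (p.lin i : ℝ) * θ i + ∑ i, ∑ j, if i ≤ j then (p.quad i j : ℝ) * θ i * θ j else 0

/-- `p` CONTAINS `x` at `θ`: `|x − p(θ)| ≤ ρ`. [folklore] -/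
def Contains (p : TM q) (θ : Fin q → ℝ) (x : ℝ) : Prop := |x - p.evalR θ| ≤ (p.rem : ℝ)

/-- The parameter box `[−1, 1]^q`. [folklore] -/
def InBox (θ : Fin q → ℝ) : Prop := ∀ i, |θ i| ≤ 1

/-- Sum of the absolute values of the linear coefficients. [folklore] -/
def linAbs (p : TM q) : ℚ := ∑ i, |p.lin i|

/-- Sum of the absolute values of the (used) quadratic coefficients. [folklore] -/
def quadAbs (p : TM q) : ℚ := ∑ i, ∑ j, if i ≤ j then |p.quad i j| else 0

/-- Bound of `|p(θ) − c₀|` over the box: `Σ|ℓ| + Σ|Q|`. [folklore] -/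
def varAbs (p : TM q) : ℚ := p.linAbs + p.quadAbs

/-- Upper end of the range over the box (including the remainder). [folklore] -/
def rangeHi (p : TM q) : ℚ := p.c0 + p.varAbs + p.rem

/-- Lower end of the range over the box (including the remainder). [folklore] -/
def rangeLo (p : TM q) : ℚ := p.c0 - p.varAbs - p.rem

/-- Sum of Taylor models. [folklore] -/
def add (p r : TM q) : TM q :=
  ⟨p.c0 + r.c0, fun i => p.lin i + r.lin i, fun i j => p.quad i j + r.quad i j, p.rem + r.rem⟩

/-- Scalar multiple of a Taylor model. [folklore] -/
def smul (a : ℚ) (p : TM q) : TM q :=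
  ⟨a * p.c0, fun i => a * p.lin i, fun i j => a * p.quad i j, |a| * p.rem⟩

/-- Product of Taylor models, truncated to degree `2`: the degree-`≤ 2` part of the product of the polynomial parts,
and a radius absorbing the cubic and quartic terms (`|θᵢ| ≤ 1`) and all remainder cross terms. [folklore] -/
def mul (p r : TM q) : TM q :=
  ⟨p.c0 * r.c0,
   fun i => p.c0 * r.lin i + r.c0 * p.lin i,
   fun i j => p.c0 * r.quad i j + r.c0 * p.quad i j +
     (if i = j then p.lin i * r.lin i else p.lin i * r.lin j + p.lin j * r.lin i),
   p.linAbs * r.quadAbs + p.quadAbs * r.linAbs + p.quadAbs * r.quadAbs +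
     p.rem * (|r.c0| + r.varAbs + r.rem) + r.rem * (|p.c0| + p.varAbs)⟩

/-! ### Soundness of the range and of `add`, `smul` -/

/-- `Σ|ℓ| ≥ 0`. -/
theorem linAbs_nonneg (p : TM q) : 0 ≤ p.linAbs := Finset.sum_nonneg fun _ _ => abs_nonneg _

/-- `Σ|Q| ≥ 0`. -/
theorem quadAbs_nonneg (p : TM q) : 0 ≤ p.quadAbs :=
  Finset.sum_nonneg fun _ _ => Finset.sum_nonneg fun _ _ => by split_ifs <;> simp [abs_nonneg]

/-- The linear part is bounded by `Σ|ℓ|` on the box. -/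
theorem abs_lin_le (p : TM q) {θ : Fin q → ℝ} (hθ : InBox θ) :
    |∑ i, (p.lin i : ℝ) * θ i| ≤ (p.linAbs : ℝ) := by
  unfold linAbs
  push_cast
  refine (Finset.abs_sum_le_sum_abs _ _).trans (Finset.sum_le_sum fun i _ => ?_)
  rw [abs_mul]
  calc |(p.lin i : ℝ)| * |θ i| ≤ |(p.lin i : ℝ)| * 1 :=
        mul_le_mul_of_nonneg_left (hθ i) (abs_nonneg _)
    _ = |(p.lin i : ℝ)| := mul_one _

/-- The quadratic part is bounded by `Σ|Q|` on the box. -/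
theorem abs_quad_le (p : TM q) {θ : Fin q → ℝ} (hθ : InBox θ) :
    |∑ i, ∑ j, if i ≤ j then (p.quad i j : ℝ) * θ i * θ j else 0| ≤ (p.quadAbs : ℝ) := by
  unfold quadAbs
  push_cast
  refine (Finset.abs_sum_le_sum_abs _ _).trans (Finset.sum_le_sum fun i _ => ?_)
  refine (Finset.abs_sum_le_sum_abs _ _).trans (Finset.sum_le_sum fun j _ => ?_)
  split_ifs
  · rw [Rat.cast_abs, abs_mul, abs_mul]
    have h1 := hθ i; have h2 := hθ j
    have : |θ i| * |θ j| ≤ 1 := by nlinarith [abs_nonneg (θ i), abs_nonneg (θ j)]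
    calc |(p.quad i j : ℝ)| * |θ i| * |θ j| = |(p.quad i j : ℝ)| * (|θ i| * |θ j|) := by ring
      _ ≤ |(p.quad i j : ℝ)| * 1 := mul_le_mul_of_nonneg_left this (abs_nonneg _)
      _ = |(p.quad i j : ℝ)| := mul_one _
  · simp

/-- `|p(θ) − c₀| ≤ Σ|ℓ| + Σ|Q|` on the box. -/
theorem abs_evalR_sub_c0_le (p : TM q) {θ : Fin q → ℝ} (hθ : InBox θ) :
    |p.evalR θ - p.c0| ≤ (p.varAbs : ℝ) := by
  unfold varAbs evalR
  push_cast
  have h1 := p.abs_lin_le hθ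
  have h2 := p.abs_quad_le hθ
  calc |((p.c0 : ℝ) + ∑ i, (p.lin i : ℝ) * θ i + ∑ i, ∑ j, if i ≤ j then (p.quad i j : ℝ) * θ i * θ j else 0) - p.c0|
      = |∑ i, (p.lin i : ℝ) * θ i + ∑ i, ∑ j, if i ≤ j then (p.quad i j : ℝ) * θ i * θ j else 0| := by ring_nf
    _ ≤ _ := (abs_add_le _ _).trans (by linarith)

/-- **Range soundness (upper)**: a contained value is `≤ rangeHi` on the box. -/
theorem le_rangeHi (p : TM q) {θ : Fin q → ℝ} (hθ : InBox θ) {x : ℝ} (hx : p.Contains θ x) :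
    x ≤ (p.rangeHi : ℝ) := by
  unfold rangeHi; unfold Contains at hx
  push_cast
  have h1 := p.abs_evalR_sub_c0_le hθ
  have := abs_le.mp hx; have := abs_le.mp h1
  linarith [this.2]

/-- **Range soundness (lower)**: a contained value is `≥ rangeLo` on the box. -/
theorem rangeLo_le (p : TM q) {θ : Fin q → ℝ} (hθ : InBox θ) {x : ℝ} (hx : p.Contains θ x) :
    (p.rangeLo : ℝ) ≤ x := by
  unfold rangeLo; unfold Contains at hx
  push_cast
  have h1 := p.abs_evalR_sub_c0_le hθ
  have := abs_le.mp hx; have := abs_le.mp h1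
  linarith [this.1]

/-- Evaluation of a sum. -/
theorem evalR_add (p r : TM q) (θ : Fin q → ℝ) : (p.add r).evalR θ = p.evalR θ + r.evalR θ := by
  unfold add evalR
  simp only
  push_cast
  rw [show (∑ i, ((p.lin i : ℝ) + r.lin i) * θ i) = (∑ i, (p.lin i : ℝ) * θ i) + ∑ i, (r.lin i : ℝ) * θ i by
    rw [← Finset.sum_add_distrib]; exact Finset.sum_congr rfl fun i _ => by ring]
  rw [show (∑ i, ∑ j, if i ≤ j then ((p.quad i j : ℝ) + r.quad i j) * θ i * θ j else 0) =
      (∑ i, ∑ j, if i ≤ j then (p.quad i j : ℝ) * θ i * θ j else 0) +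
        ∑ i, ∑ j, if i ≤ j then (r.quad i j : ℝ) * θ i * θ j else 0 by
    rw [← Finset.sum_add_distrib]; refine Finset.sum_congr rfl fun i _ => ?_
    rw [← Finset.sum_add_distrib]; refine Finset.sum_congr rfl fun j _ => ?_
    split_ifs <;> ring]
  ring

/-- **Soundness of `add`.** -/
theorem contains_add {p r : TM q} {θ : Fin q → ℝ} {x y : ℝ} (hx : p.Contains θ x) (hy : r.Contains θ y) :
    (p.add r).Contains θ (x + y) := by
  unfold Contains at *
  rw [evalR_add]
  have : (p.add r).rem = p.rem + r.rem := rfl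
  rw [this]; push_cast
  calc |x + y - (p.evalR θ + r.evalR θ)| = |(x - p.evalR θ) + (y - r.evalR θ)| := by ring_nf
    _ ≤ |x - p.evalR θ| + |y - r.evalR θ| := abs_add_le _ _
    _ ≤ _ := add_le_add hx hy

/-- Evaluation of a scalar multiple. -/
theorem evalR_smul (a : ℚ) (p : TM q) (θ : Fin q → ℝ) : (p.smul a).evalR θ = (a : ℝ) * p.evalR θ := by
  unfold smul evalR
  simp only
  push_cast
  have e1 : ∑ i, (a : ℝ) * (p.lin i : ℝ) * θ i = (a : ℝ) * ∑ i, (p.lin i : ℝ) * θ i := by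
    rw [Finset.mul_sum]; exact Finset.sum_congr rfl fun i _ => by ring
  have e2 : (∑ i, ∑ j, if i ≤ j then (a : ℝ) * (p.quad i j : ℝ) * θ i * θ j else 0) =
      (a : ℝ) * ∑ i, ∑ j, if i ≤ j then (p.quad i j : ℝ) * θ i * θ j else 0 := by
    rw [Finset.mul_sum]; refine Finset.sum_congr rfl fun i _ => ?_
    rw [Finset.mul_sum]; refine Finset.sum_congr rfl fun j _ => ?_
    split_ifs <;> ring
  rw [e1, e2]; ring

/-- **Soundness of `smul`.** -/
theorem contains_smul (a : ℚ) {p : TM q} {θ : Fin q → ℝ} {x : ℝ} (hx : p.Contains θ x) :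
    (p.smul a).Contains θ ((a : ℝ) * x) := by
  unfold Contains at *
  rw [evalR_smul]
  have : (p.smul a).rem = |a| * p.rem := rfl
  rw [this]; push_cast
  calc |(a : ℝ) * x - (a : ℝ) * p.evalR θ| = |(a : ℝ)| * |x - p.evalR θ| := by rw [← mul_sub, abs_mul]
    _ ≤ |(a : ℝ)| * p.rem := mul_le_mul_of_nonneg_left hx (abs_nonneg _)

/-! ### Soundness of the truncated product -/

/-- The symmetrised product of two linear parts, summed over `i ≤ j`, is the product of the linear parts. -/
theorem sum_linmul_eq (p r : TM q) (θ : Fin q → ℝ) :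
    (∑ i, ∑ j, if i ≤ j then
        ((if i = j then p.lin i * r.lin i else p.lin i * r.lin j + p.lin j * r.lin i : ℚ) : ℝ) * θ i * θ j
      else 0) = (∑ i, (p.lin i : ℝ) * θ i) * ∑ j, (r.lin j : ℝ) * θ j := by
  classical
  set f : Fin q → Fin q → ℝ := fun i j => (p.lin i : ℝ) * r.lin j * θ i * θ j with hf
  -- the right-hand side as a double sum
  have hR : (∑ i, (p.lin i : ℝ) * θ i) * ∑ j, (r.lin j : ℝ) * θ j = ∑ i, ∑ j, f i j := by
    rw [Finset.sum_mul]; refine Finset.sum_congr rfl fun i _ => ?_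
    rw [Finset.mul_sum]; refine Finset.sum_congr rfl fun j _ => ?_
    simp only [hf]; ring
  rw [hR]
  -- split the left summand
  have hL : ∀ i j : Fin q, (if i ≤ j then
        ((if i = j then p.lin i * r.lin i else p.lin i * r.lin j + p.lin j * r.lin i : ℚ) : ℝ) * θ i * θ j
      else 0) = (if i ≤ j then f i j else 0) + (if i < j then f j i else 0) := by
    intro i j
    by_cases hij : i ≤ j
    · rcases lt_or_eq_of_le hij with hlt | heq
      · simp only [if_pos hij, if_pos hlt, if_neg (ne_of_lt hlt), hf]
        push_cast; ring
      · subst heq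
        simp only [if_pos hij, lt_irrefl, if_false, if_true, hf]
        push_cast; ring
    · have : ¬ i < j := fun h => hij h.le
      simp only [if_neg hij, if_neg this, add_zero]
  simp_rw [hL, Finset.sum_add_distrib]
  -- split the right summand the same way
  have hsplit : ∑ i, ∑ j, f i j =
      (∑ i, ∑ j, if i ≤ j then f i j else 0) + ∑ i, ∑ j, if j < i then f i j else 0 := by
    rw [← Finset.sum_add_distrib]; refine Finset.sum_congr rfl fun i _ => ?_
    rw [← Finset.sum_add_distrib]; refine Finset.sum_congr rfl fun j _ => ?_
    by_cases hij : i ≤ j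
    · rw [if_pos hij, if_neg (not_lt.mpr hij)]; ring
    · rw [if_neg hij, if_pos (not_le.mp hij)]; ring
  rw [hsplit]
  congr 1
  rw [Finset.sum_comm]

/-- Evaluation of the truncated product: the degree-`≤ 2` part of `P·R` (the cubic and quartic terms are dropped). -/
theorem evalR_mul (p r : TM q) (θ : Fin q → ℝ) :
    (p.mul r).evalR θ =
      (p.c0 : ℝ) * r.c0 + (p.c0 : ℝ) * (∑ i, (r.lin i : ℝ) * θ i) + (r.c0 : ℝ) * (∑ i, (p.lin i : ℝ) * θ i) +
        (p.c0 : ℝ) * (∑ i, ∑ j, if i ≤ j then (r.quad i j : ℝ) * θ i * θ j else 0) +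
        (r.c0 : ℝ) * (∑ i, ∑ j, if i ≤ j then (p.quad i j : ℝ) * θ i * θ j else 0) +
        (∑ i, (p.lin i : ℝ) * θ i) * ∑ j, (r.lin j : ℝ) * θ j := by
  rw [← sum_linmul_eq p r θ]
  unfold mul evalR
  simp only
  push_cast
  have h1 : ∑ i, ((p.c0 : ℝ) * r.lin i + r.c0 * p.lin i) * θ i =
      (p.c0 : ℝ) * (∑ i, (r.lin i : ℝ) * θ i) + (r.c0 : ℝ) * ∑ i, (p.lin i : ℝ) * θ i := by
    rw [Finset.mul_sum, Finset.mul_sum, ← Finset.sum_add_distrib]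
    exact Finset.sum_congr rfl fun i _ => by ring
  have h2 : (∑ i, ∑ j, if i ≤ j then
      ((p.c0 : ℝ) * r.quad i j + r.c0 * p.quad i j +
        ((if i = j then p.lin i * r.lin i else p.lin i * r.lin j + p.lin j * r.lin i : ℚ) : ℝ)) * θ i * θ j
      else 0) =
      (p.c0 : ℝ) * (∑ i, ∑ j, if i ≤ j then (r.quad i j : ℝ) * θ i * θ j else 0) +
      (r.c0 : ℝ) * (∑ i, ∑ j, if i ≤ j then (p.quad i j : ℝ) * θ i * θ j else 0) +
      ∑ i, ∑ j, if i ≤ j then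
        ((if i = j then p.lin i * r.lin i else p.lin i * r.lin j + p.lin j * r.lin i : ℚ) : ℝ) * θ i * θ j
      else 0 := by
    rw [Finset.mul_sum, Finset.mul_sum, ← Finset.sum_add_distrib, ← Finset.sum_add_distrib]
    refine Finset.sum_congr rfl fun i _ => ?_
    rw [Finset.mul_sum, Finset.mul_sum, ← Finset.sum_add_distrib, ← Finset.sum_add_distrib]
    refine Finset.sum_congr rfl fun j _ => ?_
    by_cases hij : i ≤ j
    · simp only [if_pos hij]; ring
    · simp only [if_neg hij]; ring
  rw [h1, h2]; ring

/-- **Soundness of `mul`**: if `p` contains `x` and `r` contains `y` at a box point `θ`, then `p.mul r` contains `x·y`. -/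
theorem contains_mul {p r : TM q} {θ : Fin q → ℝ} (hθ : InBox θ) {x y : ℝ} (hx : p.Contains θ x)
    (hy : r.Contains θ y) : (p.mul r).Contains θ (x * y) := by
  unfold Contains at *
  -- names for the pieces
  set Lp : ℝ := ∑ i, (p.lin i : ℝ) * θ i with hLp
  set Lr : ℝ := ∑ i, (r.lin i : ℝ) * θ i with hLr
  set Qp : ℝ := ∑ i, ∑ j, if i ≤ j then (p.quad i j : ℝ) * θ i * θ j else 0 with hQp
  set Qr : ℝ := ∑ i, ∑ j, if i ≤ j then (r.quad i j : ℝ) * θ i * θ j else 0 with hQr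
  have hP : p.evalR θ = (p.c0 : ℝ) + Lp + Qp := rfl
  have hRv : r.evalR θ = (r.c0 : ℝ) + Lr + Qr := rfl
  have hM : (p.mul r).evalR θ =
      (p.c0 : ℝ) * r.c0 + p.c0 * Lr + r.c0 * Lp + p.c0 * Qr + r.c0 * Qp + Lp * Lr := by
    rw [evalR_mul]
  -- bounds on the pieces
  have aLp : |Lp| ≤ p.linAbs := p.abs_lin_le hθ
  have aLr : |Lr| ≤ r.linAbs := r.abs_lin_le hθ
  have aQp : |Qp| ≤ p.quadAbs := p.abs_quad_le hθ
  have aQr : |Qr| ≤ r.quadAbs := r.abs_quad_le hθ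
  -- the error decomposition
  set e₁ : ℝ := x - p.evalR θ with he₁
  set e₂ : ℝ := y - r.evalR θ with he₂
  have hxy : x * y - (p.mul r).evalR θ =
      (Lp * Qr + Qp * Lr + Qp * Qr) + e₁ * y + e₂ * ((p.c0 : ℝ) + Lp + Qp) := by
    rw [hM]
    have ex : x = (p.c0 : ℝ) + Lp + Qp + e₁ := by rw [he₁, hP]; ring
    have ey : y = (r.c0 : ℝ) + Lr + Qr + e₂ := by rw [he₂, hRv]; ring
    linear_combination y * ex + ((p.c0 : ℝ) + Lp + Qp) * ey
  have hrem : ((p.mul r).rem : ℝ) = p.linAbs * r.quadAbs + p.quadAbs * r.linAbs + p.quadAbs * r.quadAbs +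
      p.rem * (|(r.c0 : ℝ)| + r.varAbs + r.rem) + r.rem * (|(p.c0 : ℝ)| + p.varAbs) := by
    show (((p.linAbs * r.quadAbs + p.quadAbs * r.linAbs + p.quadAbs * r.quadAbs +
      p.rem * (|r.c0| + r.varAbs + r.rem) + r.rem * (|p.c0| + p.varAbs) : ℚ)) : ℝ) = _
    push_cast; ring
  rw [hxy, hrem]
  have hy' : |y| ≤ |(r.c0 : ℝ)| + r.varAbs + r.rem := by
    have h1 := r.abs_evalR_sub_c0_le hθ
    have : y = (y - r.evalR θ) + (r.evalR θ - r.c0) + r.c0 := by ring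
    rw [this]
    refine ((abs_add_le _ _).trans (add_le_add ((abs_add_le _ _).trans (add_le_add hy h1)) le_rfl)).trans ?_
    linarith
  have hPv : |(p.c0 : ℝ) + Lp + Qp| ≤ |(p.c0 : ℝ)| + p.varAbs := by
    have : ((p.varAbs : ℚ) : ℝ) = p.linAbs + p.quadAbs := by unfold varAbs; push_cast; ring
    rw [this]
    refine ((abs_add_le _ _).trans (add_le_add (abs_add_le _ _) le_rfl)).trans ?_
    linarith
  have t1 : |Lp * Qr| ≤ p.linAbs * r.quadAbs := by
    rw [abs_mul]; exact mul_le_mul aLp aQr (abs_nonneg _) ((abs_nonneg _).trans aLp)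
  have t2 : |Qp * Lr| ≤ p.quadAbs * r.linAbs := by
    rw [abs_mul]; exact mul_le_mul aQp aLr (abs_nonneg _) ((abs_nonneg _).trans aQp)
  have t3 : |Qp * Qr| ≤ p.quadAbs * r.quadAbs := by
    rw [abs_mul]; exact mul_le_mul aQp aQr (abs_nonneg _) ((abs_nonneg _).trans aQp)
  have t4 : |e₁ * y| ≤ p.rem * (|(r.c0 : ℝ)| + r.varAbs + r.rem) := by
    rw [abs_mul]; exact mul_le_mul hx hy' (abs_nonneg _) ((abs_nonneg _).trans hx)
  have t5 : |e₂ * ((p.c0 : ℝ) + Lp + Qp)| ≤ r.rem * (|(p.c0 : ℝ)| + p.varAbs) := by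
    rw [abs_mul]; exact mul_le_mul hy hPv (abs_nonneg _) ((abs_nonneg _).trans hy)
  calc |Lp * Qr + Qp * Lr + Qp * Qr + e₁ * y + e₂ * ((p.c0 : ℝ) + Lp + Qp)|
      ≤ |Lp * Qr| + |Qp * Lr| + |Qp * Qr| + |e₁ * y| + |e₂ * ((p.c0 : ℝ) + Lp + Qp)| := by
        refine (abs_add_le _ _).trans (add_le_add ((abs_add_le _ _).trans (add_le_add ((abs_add_le _ _).trans
          (add_le_add (abs_add_le _ _) le_rfl)) le_rfl)) le_rfl)
    _ ≤ _ := by linarith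

end TM

end Summit.NavierStokesRegularity.NavierStokesRegularity.Cruxes.RelayFrontStep.PhaseI
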